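import Summits.CriticalPhenomena.SAWScalingLimit.Theses.SAWLoopFugacityFlow
import Summits.CriticalPhenomena.SAWScalingLimit.Theorems.SAWLoopFugacityFlowSimpleSubseqLimitsStubRangeIsArc
import Summits.CriticalPhenomena.SAWScalingLimit.Theorems.SAWLoopFugacityFlowSimpleSubseqLimitsLineGlue
import Summits.CriticalPhenomena.SAWScalingLimit.Theorems.SimpleSubseqLimits.Negative.SimpleSubseqLimitsNecessary
import Summits.CriticalPhenomena.SAWScalingLimit.Theorems.SimpleSubseqLimits.Negative.SimpleSubseqLimitsCore
import HarnessLib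

/-!
# SHAPE — `stub_rangeIsArc` of the line `capacity-clock-no-plateau`
(crux `SAWLoopFugacityFlow.SimpleSubseqLimits`, stmt-CriticalPhenomena-4982; registered skeleton
`Summits/CriticalPhenomena/SAWScalingLimit/Cruxes/SimpleSubseqLimits/CapacityClockNoPlateau`, STUB 1)

Under the route's avoidance items `AvoidanceLimit` (stmt-10649), `SLEAvoidanceValue` (stmt-10651) and
`AvoidancePassage` (stmt-4984), taken BY NAME as hypotheses, every subsequential weak limit `ν` of the
critical `δℤ²` SAW laws of a Dobrushin domain `(D; a, b)` is carried by classes whose RANGE is the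
range of a simple chord `a → b` in `cl D` meeting `∂D` only at `a, b`.

Pure glue from landed theorems of the tree:
* `MarkedPointRevisit.Glue.avoidanceAgree_of_routeItems` — the route items give a chordal SLE(8/3) law
  `μ` of `(D; a, b)` with `AvoidanceAgree D ν μ`;
* `IsSLELaw.isProbabilityMeasure` (under `isProjectiveLimit_preWienerMeasure_holds`) and
  `Negative.ae_carrier_of_isSLELaw` — `μ` is a probability measure carried by simple chords from `a`
  to `b` in `cl D` meeting `∂D` only at `a, b`;
* `Negative.ae_source_target_range_of_weakLimitAlong` — the free clauses for `ν`
  (`source = a`, `target = b`, `range ⊆ cl D`);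
* `MarkedPointRevisit.ArcRangeGlue.stub_rangeIsArc` — the measure-theoretic SHAPE transfer, whose
  conclusion `HasArcRange D c` is the goal verbatim.

The vocabulary `IsSubseqLimit` below is VERBATIM the registered skeleton's (namespace
`…Cruxes.SimpleSubseqLimits.CapacityClockNoPlateau`) and the landed `…MarkedPointRevisit.Glue`'s; all
copies agree definitionally.
-/

noncomputable section

open MeasureTheory Filter Topology Set Metric
open Literature.Probability.RandomPlanarGeometry Literature.Probability.LatticeModels
open scoped ENNReal NNReal BoundedContinuousFunction unitInterval

namespace Summit.CriticalPhenomena.SAWScalingLimit.Theorems.SimpleSubseqLimits.CapacityClock.RangeIsArc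

open Summit.CriticalPhenomena.SAWScalingLimit.Theses.SAWLoopFugacityFlow
  (SimpleSubseqLimits AvoidanceLimit SLEAvoidanceValue AvoidancePassage)

/-- `ν` is a probability measure on curve classes that is the weak limit, along `s n → 0⁺`, of the
pushed-forward critical `δℤ²` SAW laws of `(D; a_δ, b_δ)` — the three antecedents of the crux,
verbatim (copy of the registered skeleton's `IsSubseqLimit`). [folklore] -/
def IsSubseqLimit (D : DobrushinDomain) (a b : ℝ → Site 2) (s : ℕ → ℝ)
    (ν : Measure (CurveClass ℂ)) : Prop :=
  Tendsto s atTop (𝓝[>] (0 : ℝ)) ∧ IsProbabilityMeasure ν ∧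
    ∀ f : BoundedContinuousFunction (CurveClass ℂ) ℝ,
      Tendsto (fun n => ∫ γ, f γ.curve ∂(SAW.law D.carrier (s n) (a (s n)) (b (s n)))) atTop
        (𝓝 (∫ x, f x ∂ν))

/-- **STUB 1 of the line `capacity-clock-no-plateau` — SHAPE (the range is the SLE_(8/3) arc).**
Under `AvoidanceLimit`, `SLEAvoidanceValue`, `AvoidancePassage`, for every endpoint approximation and
every subsequential weak limit `ν`, `ν`-a.e. class `c` has the RANGE of a simple chord `c'` of
`(D; a, b)` lying in `cl D` and meeting `∂D` only at `a, b`.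
Proof: the route items give an SLE(8/3) law `μ` agreeing with `ν` on all hull-avoidance events
(`Glue.avoidanceAgree_of_routeItems`); `μ` is a probability measure
(`IsSLELaw.isProbabilityMeasure`, `isProjectiveLimit_preWienerMeasure_holds`) carried by simple
boundary-avoiding chords (`Negative.ae_carrier_of_isSLELaw`); `ν` has the free clauses
(`Negative.ae_source_target_range_of_weakLimitAlong`); the landed SHAPE transfer
`ArcRangeGlue.stub_rangeIsArc` concludes. [folklore] -/
theorem stub_rangeIsArc :
    AvoidanceLimit → SLEAvoidanceValue → AvoidancePassage →
    ∀ (D : DobrushinDomain) (a b : ℝ → Site 2), SAW.IsEndpointApprox D a b →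
      ∀ (s : ℕ → ℝ) (ν : Measure (CurveClass ℂ)), IsSubseqLimit D a b s ν →
        ∀ᵐ c ∂ν, ∃ c' ∈ CurveClass.simple, c'.source = D.pt 0 ∧ c'.target = D.pt 1 ∧
          c'.range ⊆ closure D.carrier ∧ c'.range ∩ frontier D.carrier ⊆ {D.pt 0, D.pt 1} ∧
          c'.range = c.range := by
  intro hA hV hP D a b hab s ν hlim
  obtain ⟨hs, hν, hw⟩ := hlim
  haveI := hν
  have hsub : MarkedPointRevisit.Glue.IsSubseqLimit D a b s ν := ⟨hs, hν, hw⟩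
  have hfree :
      ∀ᵐ c ∂ν, c.source = D.pt 0 ∧ c.target = D.pt 1 ∧ c.range ⊆ closure D.carrier :=
    Negative.ae_source_target_range_of_weakLimitAlong (ν := ν) hab hs hw
  obtain ⟨μ, hμ, hagree⟩ :=
    MarkedPointRevisit.Glue.avoidanceAgree_of_routeItems hA hP hV hab hsub
  haveI : Fact Literature.Probability.Process.isProjectiveLimit_preWienerMeasure :=
    ⟨isProjectiveLimit_preWienerMeasure_holds⟩
  have hμP : IsProbabilityMeasure μ := hμ.isProbabilityMeasure
  have hμcar : ∀ᵐ γ ∂μ, γ ∈ CurveClass.simple ∧ γ.source = D.pt 0 ∧ γ.target = D.pt 1 ∧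
      γ.range ⊆ closure D.carrier ∧
        γ.range ∩ frontier D.carrier ⊆ {D.pt 0, D.pt 1} :=
    Negative.ae_carrier_of_isSLELaw hμ
  have hR : ∀ᵐ c ∂ν, MarkedPointRevisit.Glue.HasArcRange D c :=
    MarkedPointRevisit.ArcRangeGlue.stub_rangeIsArc D ν μ hν hμP hfree hμcar hagree
  filter_upwards [hR] with c hc
  exact hc

end Summit.CriticalPhenomena.SAWScalingLimit.Theorems.SimpleSubseqLimits.CapacityClock.RangeIsArc

end
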